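import Summits.CriticalPhenomena.PercolationContinuityZ3.Theorems.PercNearOneGluingNoHeavyLowerTailSahiOneStepThresholdTwoPrelim
import HarnessLib

/-!
# One-step scheme: the BLOCK REDUCTION LEMMA — the two one-step hypotheses descend to the section triple along common singleton generators

Support file (prover prim-ineq-prove-3 gen 15; `--supports stmt-CriticalPhenomena-4575`; memo
`run/shared/lean/prim/prim-ineq-prove-3/FINDING-G15-TH2-KERNEL.md` §3).  No definitions, no named facts, no sorries, no `native_decide`.

Setting (`…SahiOneStepCone`, `…SahiOneStepThresholdTwoPrelim`): `μ = prodBernoulli p` on `Set ι`, events `H, A, B ⊆ 2^ι`, the one-step quantities on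
indicators `m′ = osMp p H (ind A) (ind B) = (1+μH)μ(HAB) − μ(H)μ(AB) − μ(HA)μ(HB)` and
`n = osN p H (ind A) (ind B) = μ(HA)μ(HB) + (1−μH)μ(HAB) + μ(H)μ(A)μ(B) − μ(HA)μ(B) − μ(HB)μ(A)`.
Let `I` be a finset of COMMON SINGLETON GENERATORS of `A, B` (`{i} ∈ A ∩ B` for `i ∈ I`; `A, B` increasing), `C = orEvent I = {ω ∩ I ≠ ∅} ⊆ A ∩ B`,
`Z = Cᶜ`, `Q = μ(Z)`, `θ = μ(C)`, and `X^ = {ω | ω ∖ I ∈ X}` the outer sections ("`I` closed"; `Z ∩ X = Z ∩ X^`, `μ(Z ∩ X) = Qμ(X^)`).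

* `osMp_ind_ind_block_eq` — the EXACT identity
  `m′(H;A,B) = Q·[ m′(H^;A^,B^) + δ·β + θ·(x_H − x_A)(x_H − x_B) ]`, `x_H = μ(H^)`, `x_A = μ(H^∩A^)`, `x_B = μ(H^∩B^)`,
  `δ = μ(C∩H) − θ·x_H`, `β = (1−x_A)(1−x_B) + (x_H − x_A x_B) − μ(A^∩B^ ∖ H^)`;
* `osN_ind_ind_block_eq` — the EXACT identity `n(H;A,B) = Q²·n(H^;A^,B^) + Q²·δ·(1−μA^)(1−μB^) + μ(C∖H)·Q·μ(H^ ∖ (A^∪B^))`;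
* `mul_osMp_hat_le`, `sq_mul_osN_hat_le` — for `H` increasing all extra terms are `≥ 0`, so `Q·m′(H^;A^,B^) ≤ m′(H;A,B)` and `Q²·n(H^;A^,B^) ≤ n(H;A,B)`;
* `osMp_ind_ind_nonneg_of_hat`, `osN_ind_ind_nonneg_of_hat` — **REDUCTION**: the one-step hypotheses for `(H, A, B)` follow from those for the section
  triple `(H^, A^, B^)` (which lives on the cube `F ∖ I` when `H, A, B` are determined by `F`).  Consequently, for every first slot `H` the hypotheses of
  `sahiE3_nonneg_of_ind` need only be verified on CORES — pairs of up-sets without common singleton generator, against the sections of `H`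
  (for `H ⊇ Th₂(F)` the cores have `A ∩ B ⊆ H` and `…SahiOneStepThresholdTwo` is the case where they are one Harris inequality each).
-/

noncomputable section

namespace Summit.CriticalPhenomena.PercolationContinuityZ3.Theorems

namespace SahiOneStep

open MeasureTheory
open Literature.Probability.Percolation (DeterminedBy determinedBy_iff)
open Literature.Probability.LatticeModels (prodBernoulli sahiE3 prodBernoulli_real_inter_of_determinedBy prodBernoulli_harris
  prodBernoulli_harris_upper_lower)
open Literature.Probability.Percolation.DecisionTree (ind)
open SahiCdd (orEvent)
open scoped Classical

variable {ι : Type*} [Fintype ι]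

/-! ## The block identities for `μ(X)`, `X ∈ {H, HA, HB, HAB, A, B, AB}` -/

/-- For `X ⊇ C = orEvent I`: `μ(X ∩ Y) = μ(C ∩ Y) + μ(Z)·μ((X ∩ Y)^)` is the generic splitting; here the seven instances used below, bundled:
with `C ⊆ A ∩ B`, `μ(H∩A∩B) = μ(C∩H) + μ(Z)μ(H^∩A^∩B^)`, `μ(H∩A) = μ(C∩H) + μ(Z)μ(H^∩A^)`, `μ(H∩B) = μ(C∩H) + μ(Z)μ(H^∩B^)`,
`μ(H) = μ(C∩H) + μ(Z)μ(H^)`, `μ(A∩B) = μ(C) + μ(Z)μ(A^∩B^)`, `μ(A) = μ(C) + μ(Z)μ(A^)`, `μ(B) = μ(C) + μ(Z)μ(B^)`. [this work] -/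
theorem block_identities (p : ι → unitInterval) {H A B : Set (Set ι)} {I : Finset ι} (hCI : (orEvent I : Set (Set ι)) ⊆ A ∩ B) :
    ((prodBernoulli p).real (H ∩ A ∩ B) =
        (prodBernoulli p).real ((orEvent I : Set (Set ι)) ∩ H) + (prodBernoulli p).real (orEvent I : Set (Set ι))ᶜ *
          (prodBernoulli p).real ({ω : Set ι | ω \ (I : Set ι) ∈ H} ∩ {ω : Set ι | ω \ (I : Set ι) ∈ A} ∩
            {ω : Set ι | ω \ (I : Set ι) ∈ B})) ∧
    ((prodBernoulli p).real (H ∩ A) =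
        (prodBernoulli p).real ((orEvent I : Set (Set ι)) ∩ H) + (prodBernoulli p).real (orEvent I : Set (Set ι))ᶜ *
          (prodBernoulli p).real ({ω : Set ι | ω \ (I : Set ι) ∈ H} ∩ {ω : Set ι | ω \ (I : Set ι) ∈ A})) ∧
    ((prodBernoulli p).real (H ∩ B) =
        (prodBernoulli p).real ((orEvent I : Set (Set ι)) ∩ H) + (prodBernoulli p).real (orEvent I : Set (Set ι))ᶜ *
          (prodBernoulli p).real ({ω : Set ι | ω \ (I : Set ι) ∈ H} ∩ {ω : Set ι | ω \ (I : Set ι) ∈ B})) ∧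
    ((prodBernoulli p).real H =
        (prodBernoulli p).real ((orEvent I : Set (Set ι)) ∩ H) + (prodBernoulli p).real (orEvent I : Set (Set ι))ᶜ *
          (prodBernoulli p).real {ω : Set ι | ω \ (I : Set ι) ∈ H}) ∧
    ((prodBernoulli p).real (A ∩ B) =
        (prodBernoulli p).real (orEvent I : Set (Set ι)) + (prodBernoulli p).real (orEvent I : Set (Set ι))ᶜ *
          (prodBernoulli p).real ({ω : Set ι | ω \ (I : Set ι) ∈ A} ∩ {ω : Set ι | ω \ (I : Set ι) ∈ B})) ∧
    ((prodBernoulli p).real A =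
        (prodBernoulli p).real (orEvent I : Set (Set ι)) + (prodBernoulli p).real (orEvent I : Set (Set ι))ᶜ *
          (prodBernoulli p).real {ω : Set ι | ω \ (I : Set ι) ∈ A}) ∧
    ((prodBernoulli p).real B =
        (prodBernoulli p).real (orEvent I : Set (Set ι)) + (prodBernoulli p).real (orEvent I : Set (Set ι))ᶜ *
          (prodBernoulli p).real {ω : Set ι | ω \ (I : Set ι) ∈ B}) := by
  set C : Set (Set ι) := orEvent I with hC
  refine ⟨?_, ?_, ?_, ?_, ?_, ?_, ?_⟩
  · rw [real_eq_orEvent_inter_add p I (H ∩ A ∩ B), real_compl_orEvent_inter p I (H ∩ A ∩ B), sdiff_mem_inter, sdiff_mem_inter]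
    have hs : C ∩ (H ∩ A ∩ B) = C ∩ H := by
      ext ω; simp only [Set.mem_inter_iff]
      exact ⟨fun h => ⟨h.1, h.2.1.1⟩, fun h => ⟨h.1, ⟨h.2, (hCI h.1).1⟩, (hCI h.1).2⟩⟩
    rw [hs]
  · rw [real_eq_orEvent_inter_add p I (H ∩ A), real_compl_orEvent_inter p I (H ∩ A), sdiff_mem_inter]
    have hs : C ∩ (H ∩ A) = C ∩ H := by
      ext ω; simp only [Set.mem_inter_iff]
      exact ⟨fun h => ⟨h.1, h.2.1⟩, fun h => ⟨h.1, h.2, (hCI h.1).1⟩⟩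
    rw [hs]
  · rw [real_eq_orEvent_inter_add p I (H ∩ B), real_compl_orEvent_inter p I (H ∩ B), sdiff_mem_inter]
    have hs : C ∩ (H ∩ B) = C ∩ H := by
      ext ω; simp only [Set.mem_inter_iff]
      exact ⟨fun h => ⟨h.1, h.2.1⟩, fun h => ⟨h.1, h.2, (hCI h.1).2⟩⟩
    rw [hs]
  · rw [real_eq_orEvent_inter_add p I H, real_compl_orEvent_inter p I H]
  · rw [real_eq_orEvent_inter_add p I (A ∩ B), real_compl_orEvent_inter p I (A ∩ B), sdiff_mem_inter, Set.inter_eq_left.2 hCI]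
  · rw [real_eq_orEvent_inter_add p I A, real_compl_orEvent_inter p I A, Set.inter_eq_left.2 (hCI.trans Set.inter_subset_left)]
  · rw [real_eq_orEvent_inter_add p I B, real_compl_orEvent_inter p I B, Set.inter_eq_left.2 (hCI.trans Set.inter_subset_right)]

/-! ## The exact reduction identities -/

/-- **BLOCK IDENTITY for `m′`.**  For increasing `A, B` and a finset `I` of common singleton generators (`C = orEvent I`, `Z = Cᶜ`, sections `X^`):
`m′(H;A,B) = μ(Z)·[ m′(H^;A^,B^) + (μ(C∩H) − μ(C)μ(H^))·((1 − μ(H^A^))(1 − μ(H^B^)) + (μ(H^) − μ(H^A^)μ(H^B^)) − (μ(A^B^) − μ(H^A^B^)))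
  + μ(C)·(μ(H^) − μ(H^A^))(μ(H^) − μ(H^B^)) ]`. [this work] -/
theorem osMp_ind_ind_block_eq (p : ι → unitInterval) (H : Set (Set ι)) {A B : Set (Set ι)} (hA : IsUpperSet A) (hB : IsUpperSet B)
    {I : Finset ι} (hI : ∀ i ∈ I, ({i} : Set ι) ∈ A ∩ B) :
    osMp p H (ind A) (ind B) =
      (prodBernoulli p).real (orEvent I : Set (Set ι))ᶜ *
        (osMp p {ω : Set ι | ω \ (I : Set ι) ∈ H} (ind {ω : Set ι | ω \ (I : Set ι) ∈ A}) (ind {ω : Set ι | ω \ (I : Set ι) ∈ B})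
          + ((prodBernoulli p).real ((orEvent I : Set (Set ι)) ∩ H)
              - (prodBernoulli p).real (orEvent I : Set (Set ι)) * (prodBernoulli p).real {ω : Set ι | ω \ (I : Set ι) ∈ H}) *
            ((1 - (prodBernoulli p).real ({ω : Set ι | ω \ (I : Set ι) ∈ H} ∩ {ω : Set ι | ω \ (I : Set ι) ∈ A})) *
                (1 - (prodBernoulli p).real ({ω : Set ι | ω \ (I : Set ι) ∈ H} ∩ {ω : Set ι | ω \ (I : Set ι) ∈ B}))
              + ((prodBernoulli p).real {ω : Set ι | ω \ (I : Set ι) ∈ H}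
                - (prodBernoulli p).real ({ω : Set ι | ω \ (I : Set ι) ∈ H} ∩ {ω : Set ι | ω \ (I : Set ι) ∈ A}) *
                  (prodBernoulli p).real ({ω : Set ι | ω \ (I : Set ι) ∈ H} ∩ {ω : Set ι | ω \ (I : Set ι) ∈ B}))
              - ((prodBernoulli p).real ({ω : Set ι | ω \ (I : Set ι) ∈ A} ∩ {ω : Set ι | ω \ (I : Set ι) ∈ B})
                - (prodBernoulli p).real ({ω : Set ι | ω \ (I : Set ι) ∈ H} ∩ {ω : Set ι | ω \ (I : Set ι) ∈ A} ∩
                    {ω : Set ι | ω \ (I : Set ι) ∈ B})))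
          + (prodBernoulli p).real (orEvent I : Set (Set ι)) *
            (((prodBernoulli p).real {ω : Set ι | ω \ (I : Set ι) ∈ H}
                - (prodBernoulli p).real ({ω : Set ι | ω \ (I : Set ι) ∈ H} ∩ {ω : Set ι | ω \ (I : Set ι) ∈ A})) *
              ((prodBernoulli p).real {ω : Set ι | ω \ (I : Set ι) ∈ H}
                - (prodBernoulli p).real ({ω : Set ι | ω \ (I : Set ι) ∈ H} ∩ {ω : Set ι | ω \ (I : Set ι) ∈ B})))) := by
  have hCI : (orEvent I : Set (Set ι)) ⊆ A ∩ B := orEvent_subset_inter hA hB hI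
  obtain ⟨e1, e2, e3, e4, e5, -, -⟩ := block_identities p (H := H) hCI
  have e6 : (prodBernoulli p).real (orEvent I : Set (Set ι))ᶜ = 1 - (prodBernoulli p).real (orEvent I : Set (Set ι)) := by
    have h := real_orEvent_add_compl p I
    linarith
  rw [osMp_ind_ind, osMp_ind_ind, e1, e2, e3, e4, e5, e6]
  ring

/-- **BLOCK IDENTITY for `n`.**  Same setting:
`n(H;A,B) = μ(Z)²·n(H^;A^,B^) + μ(Z)²·(μ(C∩H) − μ(C)μ(H^))·(1 − μA^)(1 − μB^) + (μ(C) − μ(C∩H))·μ(Z)·(μH^ − μ(H^A^) − μ(H^B^) + μ(H^A^B^))`.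
[this work] -/
theorem osN_ind_ind_block_eq (p : ι → unitInterval) (H : Set (Set ι)) {A B : Set (Set ι)} (hA : IsUpperSet A) (hB : IsUpperSet B)
    {I : Finset ι} (hI : ∀ i ∈ I, ({i} : Set ι) ∈ A ∩ B) :
    osN p H (ind A) (ind B) =
      (prodBernoulli p).real (orEvent I : Set (Set ι))ᶜ ^ 2 *
          osN p {ω : Set ι | ω \ (I : Set ι) ∈ H} (ind {ω : Set ι | ω \ (I : Set ι) ∈ A}) (ind {ω : Set ι | ω \ (I : Set ι) ∈ B})
        + (prodBernoulli p).real (orEvent I : Set (Set ι))ᶜ ^ 2 *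
          ((prodBernoulli p).real ((orEvent I : Set (Set ι)) ∩ H)
              - (prodBernoulli p).real (orEvent I : Set (Set ι)) * (prodBernoulli p).real {ω : Set ι | ω \ (I : Set ι) ∈ H}) *
          ((1 - (prodBernoulli p).real {ω : Set ι | ω \ (I : Set ι) ∈ A}) * (1 - (prodBernoulli p).real {ω : Set ι | ω \ (I : Set ι) ∈ B}))
        + ((prodBernoulli p).real (orEvent I : Set (Set ι)) - (prodBernoulli p).real ((orEvent I : Set (Set ι)) ∩ H)) *
          (prodBernoulli p).real (orEvent I : Set (Set ι))ᶜ *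
          ((prodBernoulli p).real {ω : Set ι | ω \ (I : Set ι) ∈ H}
            - (prodBernoulli p).real ({ω : Set ι | ω \ (I : Set ι) ∈ H} ∩ {ω : Set ι | ω \ (I : Set ι) ∈ A})
            - (prodBernoulli p).real ({ω : Set ι | ω \ (I : Set ι) ∈ H} ∩ {ω : Set ι | ω \ (I : Set ι) ∈ B})
            + (prodBernoulli p).real ({ω : Set ι | ω \ (I : Set ι) ∈ H} ∩ {ω : Set ι | ω \ (I : Set ι) ∈ A} ∩
                {ω : Set ι | ω \ (I : Set ι) ∈ B})) := by
  have hCI : (orEvent I : Set (Set ι)) ⊆ A ∩ B := orEvent_subset_inter hA hB hI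
  obtain ⟨e1, e2, e3, e4, -, e6, e7⟩ := block_identities p (H := H) hCI
  have e8 : (prodBernoulli p).real (orEvent I : Set (Set ι))ᶜ = 1 - (prodBernoulli p).real (orEvent I : Set (Set ι)) := by
    have h := real_orEvent_add_compl p I
    linarith
  rw [osN_ind_ind, osN_ind_ind, e1, e2, e3, e4, e6, e7, e8]
  ring

/-! ## The reduction inequalities -/

/-- `δ = μ(C ∩ H) − μ(C)·μ(H^) ≥ 0` for increasing `H` (`μ(C)μ(H^) = μ(C ∩ H^)` and `H^ ⊆ H`). [this work] -/
theorem real_orEvent_mul_hat_le (p : ι → unitInterval) {H : Set (Set ι)} (hH : IsUpperSet H) (I : Finset ι) :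
    (prodBernoulli p).real (orEvent I : Set (Set ι)) * (prodBernoulli p).real {ω : Set ι | ω \ (I : Set ι) ∈ H} ≤
      (prodBernoulli p).real ((orEvent I : Set (Set ι)) ∩ H) := by
  rw [← real_orEvent_inter_sdiff_mem p I H]
  exact measureReal_mono (Set.inter_subset_inter_right _ (sdiff_mem_subset hH _))

/-- **REDUCTION for `m′`**: `μ(Z)·m′(H^;A^,B^) ≤ m′(H;A,B)` (`H, A, B` increasing, `I` common singleton generators of `A, B`). [this work] -/
theorem mul_osMp_hat_le (p : ι → unitInterval) {H A B : Set (Set ι)} (hH : IsUpperSet H) (hA : IsUpperSet A) (hB : IsUpperSet B)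
    {I : Finset ι} (hI : ∀ i ∈ I, ({i} : Set ι) ∈ A ∩ B) :
    (prodBernoulli p).real (orEvent I : Set (Set ι))ᶜ *
        osMp p {ω : Set ι | ω \ (I : Set ι) ∈ H} (ind {ω : Set ι | ω \ (I : Set ι) ∈ A}) (ind {ω : Set ι | ω \ (I : Set ι) ∈ B}) ≤
      osMp p H (ind A) (ind B) := by
  rw [osMp_ind_ind_block_eq p H hA hB hI]
  set μ := prodBernoulli p with hμ
  set C : Set (Set ι) := orEvent I with hC
  set Hh : Set (Set ι) := {ω : Set ι | ω \ (I : Set ι) ∈ H} with hHh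
  set Ah : Set (Set ι) := {ω : Set ι | ω \ (I : Set ι) ∈ A} with hAh
  set Bh : Set (Set ι) := {ω : Set ι | ω \ (I : Set ι) ∈ B} with hBh
  have hδ : 0 ≤ μ.real (C ∩ H) - μ.real C * μ.real Hh := by
    have h := real_orEvent_mul_hat_le p hH I
    linarith
  have mA : μ.real (Hh ∩ Ah) ≤ μ.real Hh := measureReal_mono Set.inter_subset_left
  have mB : μ.real (Hh ∩ Bh) ≤ μ.real Hh := measureReal_mono Set.inter_subset_left
  have mH : μ.real Hh ≤ 1 := measureReal_le_one
  have n0A : 0 ≤ μ.real (Hh ∩ Ah) := measureReal_nonneg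
  have n0B : 0 ≤ μ.real (Hh ∩ Bh) := measureReal_nonneg
  have nθ : 0 ≤ μ.real C := measureReal_nonneg
  have nQ : 0 ≤ μ.real Cᶜ := measureReal_nonneg
  -- the low common part of the sections is at most `μ(H^ᶜ) = 1 − μ(H^)`
  have hs : μ.real (Ah ∩ Bh) - μ.real (Hh ∩ Ah ∩ Bh) ≤ 1 - μ.real Hh := by
    have h1 : μ.real (Ah ∩ Bh) - μ.real (Hh ∩ Ah ∩ Bh) = μ.real (Hhᶜ ∩ (Ah ∩ Bh)) := by
      rw [real_compl_inter p Hh (Ah ∩ Bh), Set.inter_assoc]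
    rw [h1, ← probReal_compl_eq_one_sub (μ := μ) (MeasurableSet.of_discrete : MeasurableSet Hh)]
    exact measureReal_mono Set.inter_subset_left
  have hβ : 0 ≤ (1 - μ.real (Hh ∩ Ah)) * (1 - μ.real (Hh ∩ Bh)) + (μ.real Hh - μ.real (Hh ∩ Ah) * μ.real (Hh ∩ Bh))
      - (μ.real (Ah ∩ Bh) - μ.real (Hh ∩ Ah ∩ Bh)) := by nlinarith
  have hγ : 0 ≤ (μ.real Hh - μ.real (Hh ∩ Ah)) * (μ.real Hh - μ.real (Hh ∩ Bh)) := mul_nonneg (by linarith) (by linarith)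
  nlinarith [mul_nonneg nQ (mul_nonneg hδ hβ), mul_nonneg nQ (mul_nonneg nθ hγ)]

/-- **REDUCTION for `n`**: `μ(Z)²·n(H^;A^,B^) ≤ n(H;A,B)`. [this work] -/
theorem sq_mul_osN_hat_le (p : ι → unitInterval) {H A B : Set (Set ι)} (hH : IsUpperSet H) (hA : IsUpperSet A) (hB : IsUpperSet B)
    {I : Finset ι} (hI : ∀ i ∈ I, ({i} : Set ι) ∈ A ∩ B) :
    (prodBernoulli p).real (orEvent I : Set (Set ι))ᶜ ^ 2 *
        osN p {ω : Set ι | ω \ (I : Set ι) ∈ H} (ind {ω : Set ι | ω \ (I : Set ι) ∈ A}) (ind {ω : Set ι | ω \ (I : Set ι) ∈ B}) ≤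
      osN p H (ind A) (ind B) := by
  rw [osN_ind_ind_block_eq p H hA hB hI]
  set μ := prodBernoulli p with hμ
  set C : Set (Set ι) := orEvent I with hC
  set Hh : Set (Set ι) := {ω : Set ι | ω \ (I : Set ι) ∈ H} with hHh
  set Ah : Set (Set ι) := {ω : Set ι | ω \ (I : Set ι) ∈ A} with hAh
  set Bh : Set (Set ι) := {ω : Set ι | ω \ (I : Set ι) ∈ B} with hBh
  have hδ : 0 ≤ μ.real (C ∩ H) - μ.real C * μ.real Hh := by
    have h := real_orEvent_mul_hat_le p hH I
    linarith
  have hσ : 0 ≤ μ.real C - μ.real (C ∩ H) := by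
    have h : μ.real (C ∩ H) ≤ μ.real C := measureReal_mono Set.inter_subset_left
    linarith
  have hν : 0 ≤ μ.real Hh - μ.real (Hh ∩ Ah) - μ.real (Hh ∩ Bh) + μ.real (Hh ∩ Ah ∩ Bh) := by
    have h := real_inter_add_inter_le p Hh Ah Bh
    linarith
  have ha : μ.real Ah ≤ 1 := measureReal_le_one
  have hb : μ.real Bh ≤ 1 := measureReal_le_one
  have nQ : 0 ≤ μ.real Cᶜ := measureReal_nonneg
  have t1 : 0 ≤ μ.real Cᶜ ^ 2 * (μ.real (C ∩ H) - μ.real C * μ.real Hh) * ((1 - μ.real Ah) * (1 - μ.real Bh)) :=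
    mul_nonneg (mul_nonneg (pow_nonneg nQ 2) hδ) (mul_nonneg (by linarith) (by linarith))
  have t2 : 0 ≤ (μ.real C - μ.real (C ∩ H)) * μ.real Cᶜ *
      (μ.real Hh - μ.real (Hh ∩ Ah) - μ.real (Hh ∩ Bh) + μ.real (Hh ∩ Ah ∩ Bh)) :=
    mul_nonneg (mul_nonneg hσ nQ) hν
  linarith [t1, t2]

/-- **REDUCTION LEMMA, hypothesis (3′)**: if `m′ ≥ 0` for the section triple `(H^, A^, B^)` then `m′ ≥ 0` for `(H, A, B)`. [this work] -/
theorem osMp_ind_ind_nonneg_of_hat (p : ι → unitInterval) {H A B : Set (Set ι)} (hH : IsUpperSet H) (hA : IsUpperSet A)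
    (hB : IsUpperSet B) {I : Finset ι} (hI : ∀ i ∈ I, ({i} : Set ι) ∈ A ∩ B)
    (h : 0 ≤ osMp p {ω : Set ι | ω \ (I : Set ι) ∈ H} (ind {ω : Set ι | ω \ (I : Set ι) ∈ A}) (ind {ω : Set ι | ω \ (I : Set ι) ∈ B})) :
    0 ≤ osMp p H (ind A) (ind B) :=
  le_trans (mul_nonneg measureReal_nonneg h) (mul_osMp_hat_le p hH hA hB hI)

/-- **REDUCTION LEMMA, hypothesis (2′)**: if `n ≥ 0` for the section triple `(H^, A^, B^)` then `n ≥ 0` for `(H, A, B)`. [this work] -/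
theorem osN_ind_ind_nonneg_of_hat (p : ι → unitInterval) {H A B : Set (Set ι)} (hH : IsUpperSet H) (hA : IsUpperSet A)
    (hB : IsUpperSet B) {I : Finset ι} (hI : ∀ i ∈ I, ({i} : Set ι) ∈ A ∩ B)
    (h : 0 ≤ osN p {ω : Set ι | ω \ (I : Set ι) ∈ H} (ind {ω : Set ι | ω \ (I : Set ι) ∈ A}) (ind {ω : Set ι | ω \ (I : Set ι) ∈ B})) :
    0 ≤ osN p H (ind A) (ind B) :=
  le_trans (mul_nonneg (pow_nonneg measureReal_nonneg 2) h) (sq_mul_osN_hat_le p hH hA hB hI)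

end SahiOneStep

end Summit.CriticalPhenomena.PercolationContinuityZ3.Theorems
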